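import Summits.BirchSwinnertonDyer.BirchSwinnertonDyer.Theorems.BiquadraticEisensteinDescentEisensteinHeartFlatCMInertBadKPrimeAvatarRigidity
import Summits.BirchSwinnertonDyer.Rank1Residual.X11b.Three.LambdaSupplyTwistFamily
import Summits.BirchSwinnertonDyer.Rank1Residual.X11b.InterpolationCharacterSupply
import Literature.NumberTheory.GaloisRepresentations.HeckeCharacterInfinityTypeBaseChangeProofs
import Literature.NumberTheory.GaloisRepresentations.HeckeCharacterCompRelNormValueProofs
import Literature.NumberTheory.GaloisRepresentations.CMTypeHeckeCharacter
import HarnessLib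

set_option linter.dupNamespace false -- `Summit.BirchSwinnertonDyer.BirchSwinnertonDyer.Theorems.…` (summit = sub, D-0017)
set_option autoImplicit false

/-!
# Crux `EisensteinHeartFlatCMInertBadKPrime` (stmt-BirchSwinnertonDyer-21341), line `hsieh_lambda`, road (B′):
# CLASSIFICATION OF HSIEH'S RANGE on the anticyclotomic line of an imaginary quadratic field with `p ∤ h`

Route `BiquadraticEisensteinDescent` (cell `pub/bsd-wall`, lead-prover seat `bsd-wall-cm-bed-p1` g7). THEOREMS ONLY; supports, does not
close, stmt-BirchSwinnertonDyer-21341.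

Hsieh's range on the `K′`-line (the index set of `IsHsiehLFunction`, `X11b.R1.IsBDPLFunctionInt` and of the Katz base-change line read
downstairs) consists of the Hecke characters `χ` of `K′` that are unramified at every finite place, of infinity type `(n, −n)` with
`n ≥ 1`, together with a `p`-adic avatar `r` factoring through the anticyclotomic `ℤ_p`-extension `κ`. For `K′` imaginary quadratic,
`p` odd, `κ` anticyclotomic and `p ∤ h_{K′}`:

* §1 `prod_valueAtUniformizer_compRelNorm_eq_one_of_hasInfinityType_zero` — a range-type character `ξ` of infinity type `(0,0)` has
  `∏_{w ∈ X} (ξ∘N_{L/K′})(ϖ_w)^{e_w} = 1` for every finite set `X` of places of any Galois `L ⊇ K′` and all exponents (its uniformiser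
  values are all `1`, `…AvatarRigidity.valueAtUniformizer_eq_one_of_hasInfinityType_zero`).
* §2 `exists_eq_pow_mul_of_minimal` — if `n₀ ≥ 1` is the least type occurring in the range and `φ₁` has type `n₀`, every range
  character `χ` of type `n` is `φ₁^q · ξ` with `n = q·n₀` and `ξ` of range type `(0, 0)` (Euclidean division of the type; the
  remainder character would contradict minimality).
* §3 `exists_defect_eq_pow` — hence any «multiplicative defect» `δ(χ) = ∏_{w ∈ X} (χ∘N)(ϖ_w)^{e_w}` on the range satisfies
  `δ(χ) = δ(φ₁)^q` with `n = q·n₀` — the input of the sequel `…KatzLineFromFlat`, where the Katz display on the `K′`-line is matched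
  with Castella's display after ONE choice of constants.

Nothing about the crux's input or any case of BSD is asserted.

References: [Washington1997] §13.1; [CasselsFrohlichANT1967] Ch. VII §1.2, §5.1; [Brink2007] Cor. 1.
-/

noncomputable section

open scoped Classical NumberField
open NumberField IsDedekindDomain Field
open Literature.NumberTheory.GaloisRepresentations Literature.NumberTheory.EllipticCurves
open Summit.BirchSwinnertonDyer.Rank1Residual.X11b.Three.LambdaSupply
open Summit.BirchSwinnertonDyer.Rank1Residual.X11b.LambdaSupply (factorsThroughZp_unitsChar_pow)

namespace Summit.BirchSwinnertonDyer.BirchSwinnertonDyer.Theorems.BiquadraticEisensteinDescentEisensteinHeartFlatCMInertBadKPrimeRangeClassification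

open Summit.BirchSwinnertonDyer.BirchSwinnertonDyer.Theorems.BiquadraticEisensteinDescentEisensteinHeartFlatCMInertBadKPrimeAvatarRigidity
  (valueAtUniformizer_eq_one_of_hasInfinityType_zero)

variable {K : Type} [Field K] [NumberField K] {p : ℕ} [Fact p.Prime]

/-! ### §1 Type-zero range characters have trivial defects -/

/-- **A range character of infinity type `(0,0)` has every defect equal to `1`**: for `L ⊇ K′` Galois, a finite set `X` of places
of `L` and exponents `e`, `∏_{w ∈ X} (ξ ∘ N_{L/K′})(ϖ_w)^{e_w} = 1`, because `(ξ∘N)(ϖ_w) = ξ(ϖ_v)^{f(w|v)}`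
(`HeckeCharacter.compRelNorm_valueAtUniformizer_eq_pow'`) and `ξ(ϖ_v) = 1` (`…AvatarRigidity`).
[cite: CasselsFrohlichANT1967, Ch. VII §1.2] [cite: Brink2007, Cor. 1 (p. 2136)] -/
theorem prod_valueAtUniformizer_compRelNorm_eq_one_of_hasInfinityType_zero (hK : IsImaginaryQuadratic K) (hp2 : p ≠ 2)
    (κ : ZpExtension K p) (hκ : κ.IsAnticyclotomic) (hh : ¬ p ∣ NumberField.classNumber K) {ι : PadicAlgCl p ≃+* ℂ}
    {ξ : HeckeCharacter K} (h0 : ξ.HasInfinityType 0 0) (hunr : ∀ v : HeightOneSpectrum (𝓞 K), ξ.IsUnramifiedAt v)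
    {r : FramedGaloisRep K (PadicAlgCl p) 1} (hr : IsPAdicAvatarOf ι ξ r) (hfac : FactorsThroughZp κ r)
    (L : Type) [Field L] [NumberField L] [Algebra K L] [IsGalois K L] (X : Finset (HeightOneSpectrum (𝓞 L)))
    (e : HeightOneSpectrum (𝓞 L) → ℤ) :
    ∏ w ∈ X, (ξ.compRelNorm L).valueAtUniformizer w ^ e w = 1 := by
  refine Finset.prod_eq_one fun w _ ↦ ?_
  rw [HeckeCharacter.compRelNorm_valueAtUniformizer_eq_pow' ξ w (hunr _),
    valueAtUniformizer_eq_one_of_hasInfinityType_zero hK hp2 κ hκ hh h0 hunr hr hfac, one_pow, one_zpow]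

/-! ### §2 Euclidean division of the type: every range character is a power of the minimal one times a type-zero one -/

omit [NumberField K] in
/-- Products of characters through `κ` factor through `κ` (rank-one currency). [cite: Washington1997, §13.1] -/
theorem factorsThroughZp_unitsChar_mul (κ : ZpExtension K p) {ψ ψ' : absoluteGaloisGroup K →ₜ* (PadicAlgCl p)ˣ}
    (h : FactorsThroughZp κ ((FramedRep.unitsContinuousMulEquivOfUnique (Fin 1) (PadicAlgCl p) :
      (PadicAlgCl p)ˣ →ₜ* GL (Fin 1) (PadicAlgCl p)).comp ψ))
    (h' : FactorsThroughZp κ ((FramedRep.unitsContinuousMulEquivOfUnique (Fin 1) (PadicAlgCl p) :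
      (PadicAlgCl p)ˣ →ₜ* GL (Fin 1) (PadicAlgCl p)).comp ψ')) :
    FactorsThroughZp κ ((FramedRep.unitsContinuousMulEquivOfUnique (Fin 1) (PadicAlgCl p) :
      (PadicAlgCl p)ˣ →ₜ* GL (Fin 1) (PadicAlgCl p)).comp (ψ * ψ')) := by
  rw [factorsThroughZp_unitsChar_iff] at h h' ⊢
  intro σ hσ
  rw [ContinuousMonoidHom.mul_apply, h σ hσ, h' σ hσ, mul_one]

omit [NumberField K] in
/-- Inverses of characters through `κ` factor through `κ` (rank-one currency). [cite: Washington1997, §13.1] -/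
theorem factorsThroughZp_unitsChar_inv (κ : ZpExtension K p) {ψ : absoluteGaloisGroup K →ₜ* (PadicAlgCl p)ˣ}
    (h : FactorsThroughZp κ ((FramedRep.unitsContinuousMulEquivOfUnique (Fin 1) (PadicAlgCl p) :
      (PadicAlgCl p)ˣ →ₜ* GL (Fin 1) (PadicAlgCl p)).comp ψ)) :
    FactorsThroughZp κ ((FramedRep.unitsContinuousMulEquivOfUnique (Fin 1) (PadicAlgCl p) :
      (PadicAlgCl p)ˣ →ₜ* GL (Fin 1) (PadicAlgCl p)).comp ψ⁻¹) := by
  rw [factorsThroughZp_unitsChar_iff] at h ⊢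
  intro σ hσ
  rw [unitsChar_inv_apply, h σ hσ, inv_one]

/-- **Euclidean division of the type along the range.** Let `n₀ ≥ 1` be MINIMAL among the types `n ≥ 1` of range characters (everywhere
unramified, infinity type `(n, −n)`, with a `p`-adic avatar through `κ`), witnessed by `φ₁` of type `n₀`. Then every range character `χ`
of type `n` is `φ₁^q · ξ` with `n = q·n₀` and `ξ` an everywhere-unramified character of infinity type `(0,0)` admitting an avatar through
`κ` (namely `ξ = χ·(φ₁^q)⁻¹`, `q = ⌊n/n₀⌋`; the remainder type `n mod n₀` vanishes by minimality). [cite: Washington1997, §13.1] -/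
theorem exists_eq_pow_mul_of_minimal {ι : PadicAlgCl p ≃+* ℂ} (κ : ZpExtension K p) {n₀ : ℕ} (hn₀ : 0 < n₀)
    (hmin : ∀ s : ℕ, 0 < s → s < n₀ → ¬ ∃ (χ : HeckeCharacter K) (r : FramedGaloisRep K (PadicAlgCl p) 1),
      (∀ v : HeightOneSpectrum (𝓞 K), χ.IsUnramifiedAt v) ∧
        χ.HasInfinityType (fun _ ↦ (s : ℤ)) (fun _ ↦ -(s : ℤ)) ∧ IsPAdicAvatarOf ι χ r ∧ FactorsThroughZp κ r)
    {φ₁ : HeckeCharacter K} {r₁ : FramedGaloisRep K (PadicAlgCl p) 1}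
    (hu₁ : ∀ v : HeightOneSpectrum (𝓞 K), φ₁.IsUnramifiedAt v)
    (hi₁ : φ₁.HasInfinityType (fun _ ↦ (n₀ : ℤ)) (fun _ ↦ -(n₀ : ℤ)))
    (hr₁ : IsPAdicAvatarOf ι φ₁ r₁) (hf₁ : FactorsThroughZp κ r₁)
    {χ : HeckeCharacter K} {n : ℕ} {r : FramedGaloisRep K (PadicAlgCl p) 1}
    (hu : ∀ v : HeightOneSpectrum (𝓞 K), χ.IsUnramifiedAt v)
    (hi : χ.HasInfinityType (fun _ ↦ (n : ℤ)) (fun _ ↦ -(n : ℤ)))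
    (hr : IsPAdicAvatarOf ι χ r) (hf : FactorsThroughZp κ r) :
    ∃ (q : ℕ) (ξ : HeckeCharacter K) (rξ : FramedGaloisRep K (PadicAlgCl p) 1),
      n = q * n₀ ∧ χ = φ₁ ^ q * ξ ∧ ξ.HasInfinityType 0 0 ∧
        (∀ v : HeightOneSpectrum (𝓞 K), ξ.IsUnramifiedAt v) ∧ IsPAdicAvatarOf ι ξ rξ ∧ FactorsThroughZp κ rξ := by
  -- rank-one currency for the two avatars
  set e := (FramedRep.unitsContinuousMulEquivOfUnique (Fin 1) (PadicAlgCl p) :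
    (PadicAlgCl p)ˣ →ₜ* GL (Fin 1) (PadicAlgCl p)) with he
  set ψ : absoluteGaloisGroup K →ₜ* (PadicAlgCl p)ˣ :=
    ((FramedRep.unitsContinuousMulEquivOfUnique (Fin 1) (PadicAlgCl p)).symm :
      GL (Fin 1) (PadicAlgCl p) →ₜ* (PadicAlgCl p)ˣ).comp r with hψ
  set ψ₁ : absoluteGaloisGroup K →ₜ* (PadicAlgCl p)ˣ :=
    ((FramedRep.unitsContinuousMulEquivOfUnique (Fin 1) (PadicAlgCl p)).symm :
      GL (Fin 1) (PadicAlgCl p) →ₜ* (PadicAlgCl p)ˣ).comp r₁ with hψ₁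
  have hrψ : e.comp ψ = r := comp_symm_comp_eq r
  have hrψ₁ : e.comp ψ₁ = r₁ := comp_symm_comp_eq r₁
  rw [← hrψ] at hr hf
  rw [← hrψ₁] at hr₁ hf₁
  -- Euclidean division of the type
  set q : ℕ := n / n₀ with hq
  set s : ℕ := n % n₀ with hs
  have hns : n = q * n₀ + s := by rw [hq, hs, mul_comm]; exact (Nat.div_add_mod n n₀).symm
  -- the remainder character
  set ξ : HeckeCharacter K := χ * (φ₁ ^ q)⁻¹ with hξ
  have hχξ : χ = φ₁ ^ q * ξ := by rw [hξ, mul_comm, inv_mul_cancel_right]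
  have huξ : ∀ v : HeightOneSpectrum (𝓞 K), ξ.IsUnramifiedAt v := fun v ↦
    (hu v).mul' (isUnramifiedAt_pow' (hu₁ v) q).inv'
  have hiξ : ξ.HasInfinityType (fun _ ↦ (s : ℤ)) (fun _ ↦ -(s : ℤ)) := by
    have h := hi.mul' ((hi₁.zpow' (q : ℤ)).inv)
    rw [zpow_natCast] at h
    have h1 : ((fun _ : InfinitePlace K ↦ (n : ℤ)) + -((q : ℤ) • fun _ : InfinitePlace K ↦ (n₀ : ℤ))) =
        fun _ ↦ (s : ℤ) := by
      funext w
      simp only [Pi.add_apply, Pi.neg_apply, Pi.smul_apply, smul_eq_mul]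
      push_cast [hns]
      ring
    have h2 : ((fun _ : InfinitePlace K ↦ -(n : ℤ)) + -((q : ℤ) • fun _ : InfinitePlace K ↦ -(n₀ : ℤ))) =
        fun _ ↦ -(s : ℤ) := by
      funext w
      simp only [Pi.add_apply, Pi.neg_apply, Pi.smul_apply, smul_eq_mul]
      push_cast [hns]
      ring
    rw [h1, h2] at h
    exact h
  have hrξ : IsPAdicAvatarOf ι ξ (e.comp (ψ * (ψ₁ ^ q)⁻¹)) :=
    isPAdicAvatarOf_mul ι hr (isPAdicAvatarOf_inv ι (isPAdicAvatarOf_pow ι hr₁ (fun v _ ↦ hu₁ v) q))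
      (hram_of_forall (fun v _ ↦ hu v) (fun v _ ↦ (isUnramifiedAt_pow' (hu₁ v) q).inv'))
  have hfξ : FactorsThroughZp κ (e.comp (ψ * (ψ₁ ^ q)⁻¹)) :=
    factorsThroughZp_unitsChar_mul κ hf (factorsThroughZp_unitsChar_inv κ (factorsThroughZp_unitsChar_pow κ hf₁ q))
  -- the remainder vanishes
  have hs0 : s = 0 := by
    by_contra hs0
    exact hmin s (Nat.pos_of_ne_zero hs0) (by rw [hs]; exact Nat.mod_lt n hn₀) ⟨ξ, _, huξ, hiξ, hrξ, hfξ⟩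
  refine ⟨q, ξ, e.comp (ψ * (ψ₁ ^ q)⁻¹), by rw [hns, hs0, add_zero], hχξ, ?_, huξ, hrξ, hfξ⟩
  rw [hs0] at hiξ
  have h1 : (fun _ : InfinitePlace K ↦ ((0 : ℕ) : ℤ)) = 0 := by funext w; simp
  have h2 : (fun _ : InfinitePlace K ↦ -((0 : ℕ) : ℤ)) = 0 := by funext w; simp
  rw [h1, h2] at hiξ
  exact hiξ

/-! ### §3 Defects along the range are powers of the defect of the minimal character -/

/-- **Defects along the range.** In the situation of `exists_eq_pow_mul_of_minimal`, with `K` imaginary quadratic, `p` odd, `κ`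
anticyclotomic and `p ∤ h_K`: for every Galois `L ⊇ K`, finite set `X` of places of `L` and exponents `e`, the multiplicative defect
`δ(χ) = ∏_{w ∈ X} (χ∘N_{L/K})(ϖ_w)^{e_w}` of a range character `χ` of type `n` equals `δ(φ₁)^q` with `n = q·n₀`
(`δ` is multiplicative, `δ(ξ) = 1` by §1). [cite: CasselsFrohlichANT1967, Ch. VII §1.2] [cite: Brink2007, Cor. 1 (p. 2136)] -/
theorem exists_defect_eq_pow (hK : IsImaginaryQuadratic K) (hp2 : p ≠ 2) (κ : ZpExtension K p) (hκ : κ.IsAnticyclotomic)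
    (hh : ¬ p ∣ NumberField.classNumber K) {ι : PadicAlgCl p ≃+* ℂ} {n₀ : ℕ} (hn₀ : 0 < n₀)
    (hmin : ∀ s : ℕ, 0 < s → s < n₀ → ¬ ∃ (χ : HeckeCharacter K) (r : FramedGaloisRep K (PadicAlgCl p) 1),
      (∀ v : HeightOneSpectrum (𝓞 K), χ.IsUnramifiedAt v) ∧
        χ.HasInfinityType (fun _ ↦ (s : ℤ)) (fun _ ↦ -(s : ℤ)) ∧ IsPAdicAvatarOf ι χ r ∧ FactorsThroughZp κ r)
    {φ₁ : HeckeCharacter K} {r₁ : FramedGaloisRep K (PadicAlgCl p) 1}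
    (hu₁ : ∀ v : HeightOneSpectrum (𝓞 K), φ₁.IsUnramifiedAt v)
    (hi₁ : φ₁.HasInfinityType (fun _ ↦ (n₀ : ℤ)) (fun _ ↦ -(n₀ : ℤ)))
    (hr₁ : IsPAdicAvatarOf ι φ₁ r₁) (hf₁ : FactorsThroughZp κ r₁)
    {χ : HeckeCharacter K} {n : ℕ} {r : FramedGaloisRep K (PadicAlgCl p) 1}
    (hu : ∀ v : HeightOneSpectrum (𝓞 K), χ.IsUnramifiedAt v)
    (hi : χ.HasInfinityType (fun _ ↦ (n : ℤ)) (fun _ ↦ -(n : ℤ)))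
    (hr : IsPAdicAvatarOf ι χ r) (hf : FactorsThroughZp κ r)
    (L : Type) [Field L] [NumberField L] [Algebra K L] [IsGalois K L] (X : Finset (HeightOneSpectrum (𝓞 L)))
    (e : HeightOneSpectrum (𝓞 L) → ℤ) :
    ∃ q : ℕ, n = q * n₀ ∧
      ∏ w ∈ X, (χ.compRelNorm L).valueAtUniformizer w ^ e w =
        (∏ w ∈ X, (φ₁.compRelNorm L).valueAtUniformizer w ^ e w) ^ q := by
  obtain ⟨q, ξ, rξ, hnq, hχ, h0, huξ, hrξ, hfξ⟩ :=
    exists_eq_pow_mul_of_minimal κ hn₀ hmin hu₁ hi₁ hr₁ hf₁ hu hi hr hf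
  refine ⟨q, hnq, ?_⟩
  have hξ1 := prod_valueAtUniformizer_compRelNorm_eq_one_of_hasInfinityType_zero hK hp2 κ hκ hh h0 huξ hrξ hfξ L X e
  have hpow : (φ₁ ^ q).compRelNorm L = (φ₁.compRelNorm L) ^ q :=
    HeckeCharacter.ext fun y ↦ by
      rw [HeckeCharacter.compRelNorm_apply, HeckeCharacter.pow_apply, HeckeCharacter.pow_apply,
        HeckeCharacter.compRelNorm_apply]
  calc ∏ w ∈ X, (χ.compRelNorm L).valueAtUniformizer w ^ e w
      = (∏ w ∈ X, ((φ₁.compRelNorm L).valueAtUniformizer w ^ e w) ^ q) *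
          ∏ w ∈ X, (ξ.compRelNorm L).valueAtUniformizer w ^ e w := by
        rw [← Finset.prod_mul_distrib]
        refine Finset.prod_congr rfl fun w _ ↦ ?_
        rw [hχ, HeckeCharacter.compRelNorm_mul, HeckeCharacter.valueAtUniformizer_mul', mul_zpow, hpow,
          ← zpow_natCast, HeckeCharacter.valueAtUniformizer_zpow', ← zpow_mul, ← zpow_natCast, ← zpow_mul, mul_comm (e w)]
    _ = (∏ w ∈ X, (φ₁.compRelNorm L).valueAtUniformizer w ^ e w) ^ q := by
        rw [hξ1, mul_one, Finset.prod_pow]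

end Summit.BirchSwinnertonDyer.BirchSwinnertonDyer.Theorems.BiquadraticEisensteinDescentEisensteinHeartFlatCMInertBadKPrimeRangeClassification

end
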